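import Summits.Ventures.PercRepro.Night2TwoOneTypes

/-!
# PercRepro — the cell `(2, 1)` with two fat closures whose missed pairs MEET is lossless (night-2, gen 28)

Two-fat-closure clause of the `(2, 1)` nested residue (`d = 2`, one coloop, `V = G ∖ K` of rank `5`): thin members
`B₀`, `B₁` missing two points each, `H₀ = cl B₀ ≠ H₁ = cl B₁`.  When the missed pairs share a point — `G ∖ H₀ = {a, c}`,
`G ∖ H₁ = {b, c}` — NOTHING IS LOST: with `P = (H₀ ∩ H₁) ∖ K` of rank `≤ 3` a thin member contains at most one of
`a, b, c` (two leave the complement `G ∖ B` inside `P ∪ {c}`, `H₀ ∖ K` or `H₁ ∖ K`, rank `≤ 4`, against the span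
condition `rk (G ∖ B) ≥ 5`), hence exactly one, `u`; its covering sets `B ∪ {z}` have `z ∈ {a, b, c} ∖ {u}`, so the
faces at the other points contain two of `a, b, c` and are no thin members: `L1 ≤ 2 · 7/24 < 11/18 ≤ capS`.

* `localShadowHall_of_loss_eq_zero`: a flat without loss satisfies (LI_G); rank lemmas of the cell;
* `not_two_of_thin_meet`, **`loss_eq_zero_of_two_fat_meet`**, **`localShadowHall_two_one_five_two_fat_meet`**.
-/

namespace PercRepro.Shadow

open Finset PerFlat ThmH

variable {α : Type*} [DecidableEq α] {M : Matroid α} [M.Finite]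

section Lossless

variable {G : Finset α}

/-- **A flat without loss satisfies (LI_G)**: the fair-share certificate with every per-loss inequality trivial. -/
theorem localShadowHall_of_loss_eq_zero {q : ℕ} (hG : G ∈ flatsQ M (q + 1)) (hd : (gr M \ G).card ≤ q)
    (h0 : ∀ B ∈ thinMembers M q G, ∀ z ∈ G \ clF M B, loss M q G B z = 0) : LocalShadowHall M q G := by
  apply localShadowHall_of_lossFair hG hd
  intro B hB z hz
  have h := h0 B hB z hz
  unfold rhoL
  rw [h, zero_div, zero_mul]

/-- The rank of a thin member is `5`. -/
theorem rkN_eq_five_of_mem_thinMembers {B : Finset α} (hB : B ∈ thinMembers M 5 G) : rkN M B = 5 := by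
  have hBU : B ∈ Uq M (5 + 2) 5 := (mem_membersIn.1 (mem_thinMembers.1 hB).1).1
  have h := (mem_Uq.1 hBU).2.1
  rw [eRk_eq_rkN] at h
  exact_mod_cast h

/-- The off-coloop part of a thin member of the cell `(2, 1)` has rank `4`. -/
theorem rkN_sdiff_coloops_eq_four_of_thin (hG : G ∈ flatsQ M (5 + 1)) (hd : (gr M \ G).card = 2)
    (hk : kColoops M G = 1) {B : Finset α} (hB : B ∈ thinMembers M 5 G) : rkN M (B \ coloops M G) = 4 := by
  have hd' : (gr M \ G).card ≤ 5 := by omega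
  have hGg : G ⊆ gr M := (mem_flatsQ.1 hG).1
  have hB' : B ∈ membersIn M (Uq M (5 + 2) 5) G := (mem_thinMembers.1 hB).1
  have hBU : B ∈ Uq M (5 + 2) 5 := (mem_membersIn.1 hB').1
  have hBG : B ⊆ G := (subset_clF hBU).trans (mem_membersIn.1 hB').2
  have hKB : coloops M G ⊆ B := coloops_subset_of_mem_thinMembers hG hd' hB
  have h := eRk_eq_kColoops_add_sdiff hGg hBG hKB
  rw [eRk_eq_rkN, eRk_eq_rkN, hk, rkN_eq_five_of_mem_thinMembers hB] at h
  have h' : ((5 : ℕ) : ℕ∞) = ((1 + rkN M (B \ coloops M G) : ℕ) : ℕ∞) := by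
    rw [Nat.cast_add]; exact_mod_cast h
  have h'' : 5 = 1 + rkN M (B \ coloops M G) := by exact_mod_cast h'
  omega

/-- The off-coloop part of the closure of a thin member of the cell `(2, 1)` has rank `4`. -/
theorem rkN_clF_sdiff_coloops_eq_four_two (hG : G ∈ flatsQ M (5 + 1)) (hd : (gr M \ G).card = 2)
    (hk : kColoops M G = 1) {B : Finset α} (hB : B ∈ thinMembers M 5 G) :
    rkN M (clF M B \ coloops M G) = 4 := by
  have h1 := rkN_clF_sdiff_coloops_le_four_two hG hd hk hB
  have h2 : rkN M (B \ coloops M G) ≤ rkN M (clF M B \ coloops M G) := rkN_mono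
    (Finset.sdiff_subset_sdiff (subset_clF (mem_membersIn.1 (mem_thinMembers.1 hB).1).1) (Finset.Subset.refl _))
  have h3 := rkN_sdiff_coloops_eq_four_of_thin hG hd hk hB
  omega

/-- The rank of the covering set `B ∪ {z}` of a thin member is `6`. -/
theorem rkN_insert_eq_six_of_thin (hG : G ∈ flatsQ M (5 + 1)) {B : Finset α} (hB : B ∈ thinMembers M 5 G)
    {z : α} (hz : z ∈ G \ clF M B) : rkN M (insert z B) = 6 := by
  have hGg : G ⊆ gr M := (mem_flatsQ.1 hG).1
  rw [rkN_insert_of_notMem_clF (hGg (Finset.mem_sdiff.1 hz).1) (Finset.mem_sdiff.1 hz).2,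
    rkN_eq_five_of_mem_thinMembers hB]

/-- The off-coloop part of a covering set of a thin member of the cell `(2, 1)` has rank `5`. -/
theorem rkN_insert_sdiff_coloops_eq_five_of_thin (hG : G ∈ flatsQ M (5 + 1)) (hd : (gr M \ G).card = 2)
    (hk : kColoops M G = 1) {B : Finset α} (hB : B ∈ thinMembers M 5 G) {z : α} (hz : z ∈ G \ clF M B) :
    rkN M (insert z B \ coloops M G) = 5 := by
  have hd' : (gr M \ G).card ≤ 5 := by omega
  have hGg : G ⊆ gr M := (mem_flatsQ.1 hG).1
  have hB' : B ∈ membersIn M (Uq M (5 + 2) 5) G := (mem_thinMembers.1 hB).1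
  have hBU : B ∈ Uq M (5 + 2) 5 := (mem_membersIn.1 hB').1
  have hBG : B ⊆ G := (subset_clF hBU).trans (mem_membersIn.1 hB').2
  have hKB : coloops M G ⊆ B := coloops_subset_of_mem_thinMembers hG hd' hB
  have hQG : insert z B ⊆ G := Finset.insert_subset (Finset.mem_sdiff.1 hz).1 hBG
  have hKQ : coloops M G ⊆ insert z B := hKB.trans (Finset.subset_insert _ _)
  have h := eRk_eq_kColoops_add_sdiff hGg hQG hKQ
  rw [eRk_eq_rkN, eRk_eq_rkN, hk, rkN_insert_eq_six_of_thin hG hB hz] at h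
  have h' : ((6 : ℕ) : ℕ∞) = ((1 + rkN M (insert z B \ coloops M G) : ℕ) : ℕ∞) := by
    rw [Nat.cast_add]; exact_mod_cast h
  have h'' : 6 = 1 + rkN M (insert z B \ coloops M G) := by exact_mod_cast h'
  omega

/-- The plane of two fat closures with meeting missed pairs: `P = (H₁ ∩ H₀) ∖ K` has rank `≤ 3` (`b ∈ H₀ ∖ H₁`). -/
theorem rkN_plane_le_three_of_meet (hG : G ∈ flatsQ M (5 + 1)) (hd : (gr M \ G).card = 2)
    (hk : kColoops M G = 1) {B₀ B₁ : Finset α} (hB₀ : B₀ ∈ thinMembers M 5 G) (hB₁ : B₁ ∈ thinMembers M 5 G)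
    {b : α} (hbH₀ : b ∈ clF M B₀) (hbH₁ : b ∉ clF M B₁) :
    rkN M ((clF M B₁ ∩ clF M B₀) \ coloops M G) ≤ 3 := by
  have hd' : (gr M \ G).card ≤ 5 := by omega
  have hB₀' : B₀ ∈ membersIn M (Uq M (5 + 2) 5) G := (mem_thinMembers.1 hB₀).1
  have hB₁' : B₁ ∈ membersIn M (Uq M (5 + 2) 5) G := (mem_thinMembers.1 hB₁).1
  have hB₀U : B₀ ∈ Uq M (5 + 2) 5 := (mem_membersIn.1 hB₀').1
  have hB₁U : B₁ ∈ Uq M (5 + 2) 5 := (mem_membersIn.1 hB₁').1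
  have hH₀G : clF M B₀ ⊆ G := (mem_membersIn.1 hB₀').2
  have hH₁G : clF M B₁ ⊆ G := (mem_membersIn.1 hB₁').2
  have hKH₀ : coloops M G ⊆ clF M B₀ := (coloops_subset_of_mem_thinMembers hG hd' hB₀).trans (subset_clF hB₀U)
  have hKH₁ : coloops M G ⊆ clF M B₁ := (coloops_subset_of_mem_thinMembers hG hd' hB₁).trans (subset_clF hB₁U)
  exact rkN_inter_sdiff_coloops_le_three_of_hyperplanes_two hG hk hH₁G hH₀G (clF_clF B₁)
    (rkN_clF_eq_five_of_mem_Uq hB₁U) (rkN_clF_eq_five_of_mem_Uq hB₀U).le hKH₁ hKH₀ hbH₀ hbH₁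

open scoped Classical in
/-- **A THIN MEMBER CONTAINS AT MOST ONE OF THE THREE OFF-PLANE POINTS** (cell `(2, 1)`, two fat closures with
`G ∖ H₀ = {a, c}`, `G ∖ H₁ = {b, c}`): two of them leave the complement `G ∖ B` inside `P ∪ {c}`, `H₀ ∖ K` or
`H₁ ∖ K`, all of rank `≤ 4`, against the span condition. -/
theorem not_two_of_thin_meet (hG : G ∈ flatsQ M (5 + 1)) (hd : (gr M \ G).card = 2)
    (hk : kColoops M G = 1) {B₀ B₁ : Finset α} (hB₀ : B₀ ∈ thinMembers M 5 G) (hB₁ : B₁ ∈ thinMembers M 5 G)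
    {a b c : α} (hH₀ : G \ clF M B₀ = {a, c}) (hH₁ : G \ clF M B₁ = {b, c}) (hab : a ≠ b) (hac : a ≠ c)
    (hbc : b ≠ c) {B : Finset α} (hB : B ∈ thinMembers M 5 G) {x y : α} (hx : x ∈ ({a, b, c} : Finset α))
    (hy : y ∈ ({a, b, c} : Finset α)) (hxy : x ≠ y) : ¬ (x ∈ B ∧ y ∈ B) := by
  have hd' : (gr M \ G).card ≤ 5 := by omega
  have hB' : B ∈ membersIn M (Uq M (5 + 2) 5) G := (mem_thinMembers.1 hB).1
  have hBU : B ∈ Uq M (5 + 2) 5 := (mem_membersIn.1 hB').1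
  have hBG : B ⊆ G := (subset_clF hBU).trans (mem_membersIn.1 hB').2
  have hKB : coloops M G ⊆ B := coloops_subset_of_mem_thinMembers hG hd' hB
  have h5 := five_le_rkN_sdiff_of_mem_Uq_two hG hd hBU hBG
  have hH₀4 := rkN_clF_sdiff_coloops_le_four_two hG hd hk hB₀
  have hH₁4 := rkN_clF_sdiff_coloops_le_four_two hG hd hk hB₁
  -- `b ∈ H₀ ∖ H₁`
  have hbGH₁ : b ∈ G \ clF M B₁ := by rw [hH₁]; exact Finset.mem_insert_self _ _
  have hbH₀ : b ∈ clF M B₀ := by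
    by_contra hcon
    have : b ∈ G \ clF M B₀ := Finset.mem_sdiff.2 ⟨(Finset.mem_sdiff.1 hbGH₁).1, hcon⟩
    rw [hH₀, Finset.mem_insert, Finset.mem_singleton] at this
    rcases this with h | h
    · exact hab h.symm
    · exact hbc h
  have hP3 := rkN_plane_le_three_of_meet hG hd hk hB₀ hB₁ hbH₀ (Finset.mem_sdiff.1 hbGH₁).2
  -- the three containments
  have hAC : a ∈ B → c ∈ B → False := by
    intro ha hc
    have hsub : G \ B ⊆ clF M B₀ \ coloops M G := by
      intro x hx
      rw [Finset.mem_sdiff] at hx ⊢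
      refine ⟨?_, fun h => hx.2 (hKB h)⟩
      by_contra hcon
      have : x ∈ G \ clF M B₀ := Finset.mem_sdiff.2 ⟨hx.1, hcon⟩
      rw [hH₀, Finset.mem_insert, Finset.mem_singleton] at this
      rcases this with h | h
      · exact hx.2 (h ▸ ha)
      · exact hx.2 (h ▸ hc)
    have := rkN_mono (M := M) hsub
    omega
  have hBC : b ∈ B → c ∈ B → False := by
    intro hb hc
    have hsub : G \ B ⊆ clF M B₁ \ coloops M G := by
      intro x hx
      rw [Finset.mem_sdiff] at hx ⊢
      refine ⟨?_, fun h => hx.2 (hKB h)⟩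
      by_contra hcon
      have : x ∈ G \ clF M B₁ := Finset.mem_sdiff.2 ⟨hx.1, hcon⟩
      rw [hH₁, Finset.mem_insert, Finset.mem_singleton] at this
      rcases this with h | h
      · exact hx.2 (h ▸ hb)
      · exact hx.2 (h ▸ hc)
    have := rkN_mono (M := M) hsub
    omega
  have hAB : a ∈ B → b ∈ B → False := by
    intro ha hb
    have hsub : G \ B ⊆ ((clF M B₁ ∩ clF M B₀) \ coloops M G) ∪ {c} := by
      intro x hx
      rw [Finset.mem_sdiff] at hx
      rw [Finset.mem_union, Finset.mem_singleton, Finset.mem_sdiff, Finset.mem_inter]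
      by_cases hxc : x = c
      · exact Or.inr hxc
      · left
        refine ⟨⟨?_, ?_⟩, fun h => hx.2 (hKB h)⟩
        · by_contra hcon
          have : x ∈ G \ clF M B₁ := Finset.mem_sdiff.2 ⟨hx.1, hcon⟩
          rw [hH₁, Finset.mem_insert, Finset.mem_singleton] at this
          rcases this with h | h
          · exact hx.2 (h ▸ hb)
          · exact hxc h
        · by_contra hcon
          have : x ∈ G \ clF M B₀ := Finset.mem_sdiff.2 ⟨hx.1, hcon⟩
          rw [hH₀, Finset.mem_insert, Finset.mem_singleton] at this
          rcases this with h | h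
          · exact hx.2 (h ▸ ha)
          · exact hxc h
    have h1 := rkN_mono (M := M) hsub
    have h2 := rkN_union_le_add_card (M := M) ((clF M B₁ ∩ clF M B₀) \ coloops M G) {c}
    rw [Finset.card_singleton] at h2
    omega
  rintro ⟨hxB, hyB⟩
  simp only [Finset.mem_insert, Finset.mem_singleton] at hx hy
  rcases hx with rfl | rfl | rfl <;> rcases hy with rfl | rfl | rfl
  · exact hxy rfl
  · exact hAB hxB hyB
  · exact hAC hxB hyB
  · exact hAB hyB hxB
  · exact hxy rfl
  · exact hBC hxB hyB
  · exact hAC hyB hxB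
  · exact hBC hyB hxB
  · exact hxy rfl

open scoped Classical in
/-- **EVERY LOSS OF THE CELL VANISHES** (cell `(2, 1)`, two fat closures with meeting missed pairs). -/
theorem loss_eq_zero_of_two_fat_meet (hG : G ∈ flatsQ M (5 + 1)) (hd : (gr M \ G).card = 2)
    (hk : kColoops M G = 1) {B₀ B₁ : Finset α} (hB₀ : B₀ ∈ thinMembers M 5 G) (hB₁ : B₁ ∈ thinMembers M 5 G)
    {a b c : α} (hH₀ : G \ clF M B₀ = {a, c}) (hH₁ : G \ clF M B₁ = {b, c}) (hab : a ≠ b) (hac : a ≠ c)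
    (hbc : b ≠ c) {B : Finset α} (hB : B ∈ thinMembers M 5 G) {z : α} (hz : z ∈ G \ clF M B) :
    loss M 5 G B z = 0 := by
  have hd' : (gr M \ G).card ≤ 5 := by omega
  have hGg : G ⊆ gr M := (mem_flatsQ.1 hG).1
  have hB' : B ∈ membersIn M (Uq M (5 + 2) 5) G := (mem_thinMembers.1 hB).1
  have hBU : B ∈ Uq M (5 + 2) 5 := (mem_membersIn.1 hB').1
  have hBG : B ⊆ G := (subset_clF hBU).trans (mem_membersIn.1 hB').2
  have hKB : coloops M G ⊆ B := coloops_subset_of_mem_thinMembers hG hd' hB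
  have hzB : z ∉ B := notMem_of_notMem_clF hBU (Finset.mem_sdiff.1 hz).2
  have hzG : z ∈ G := (Finset.mem_sdiff.1 hz).1
  have hnot : ∀ {B : Finset α}, B ∈ thinMembers M 5 G → ∀ {x y : α}, x ∈ ({a, b, c} : Finset α) →
      y ∈ ({a, b, c} : Finset α) → x ≠ y → ¬ (x ∈ B ∧ y ∈ B) :=
    fun {B} hB {x y} hx hy hxy => not_two_of_thin_meet hG hd hk hB₀ hB₁ hH₀ hH₁ hab hac hbc hB hx hy hxy
  -- `b ∈ H₀`
  have hbGH₁ : b ∈ G \ clF M B₁ := by rw [hH₁]; exact Finset.mem_insert_self _ _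
  have hbH₀ : b ∈ clF M B₀ := by
    by_contra hcon
    have : b ∈ G \ clF M B₀ := Finset.mem_sdiff.2 ⟨(Finset.mem_sdiff.1 hbGH₁).1, hcon⟩
    rw [hH₀, Finset.mem_insert, Finset.mem_singleton] at this
    rcases this with h | h
    · exact hab h.symm
    · exact hbc h
  have hP3 := rkN_plane_le_three_of_meet hG hd hk hB₀ hB₁ hbH₀ (Finset.mem_sdiff.1 hbGH₁).2
  set P := (clF M B₁ ∩ clF M B₀) \ coloops M G with hPdef
  -- a point of `G ∖ K` outside `{a, b, c}` lies on the plane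
  have hplane : ∀ x ∈ G, x ∉ coloops M G → x ∉ ({a, b, c} : Finset α) → x ∈ P := by
    intro x hxG hxK hx3
    simp only [Finset.mem_insert, Finset.mem_singleton, not_or] at hx3
    rw [hPdef, Finset.mem_sdiff, Finset.mem_inter]
    refine ⟨⟨?_, ?_⟩, hxK⟩
    · by_contra hcon
      have : x ∈ G \ clF M B₁ := Finset.mem_sdiff.2 ⟨hxG, hcon⟩
      rw [hH₁, Finset.mem_insert, Finset.mem_singleton] at this
      rcases this with h | h
      · exact hx3.2.1 h
      · exact hx3.2.2 h
    · by_contra hcon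
      have : x ∈ G \ clF M B₀ := Finset.mem_sdiff.2 ⟨hxG, hcon⟩
      rw [hH₀, Finset.mem_insert, Finset.mem_singleton] at this
      rcases this with h | h
      · exact hx3.1 h
      · exact hx3.2.2 h
  -- `B` contains one of `a, b, c`
  have hu : ∃ u ∈ B, u ∈ ({a, b, c} : Finset α) := by
    by_contra hcon
    push Not at hcon
    have hsub : B \ coloops M G ⊆ P := by
      intro x hx
      rw [Finset.mem_sdiff] at hx
      exact hplane x (hBG hx.1) hx.2 (hcon x hx.1)
    have h1 := rkN_mono (M := M) hsub
    have h2 := rkN_sdiff_coloops_eq_four_of_thin hG hd hk hB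
    omega
  obtain ⟨u, huB, hu3⟩ := hu
  -- `B ∖ K ⊆ P ∪ {u}`
  have hBP : B \ coloops M G ⊆ insert u P := by
    intro x hx
    rw [Finset.mem_sdiff] at hx
    rw [Finset.mem_insert]
    by_cases hx3 : x ∈ ({a, b, c} : Finset α)
    · left
      by_contra hxu
      exact hnot hB hx3 hu3 hxu ⟨hx.1, huB⟩
    · exact Or.inr (hplane x (hBG hx.1) hx.2 hx3)
  -- `z` is one of `a, b, c`
  have hz3 : z ∈ ({a, b, c} : Finset α) := by
    by_contra hcon
    have hzK : z ∉ coloops M G := fun h => hzB (hKB h)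
    have hzP : z ∈ P := hplane z hzG hzK hcon
    have hsub : insert z B \ coloops M G ⊆ insert u P := by
      intro x hx
      rw [Finset.mem_sdiff, Finset.mem_insert] at hx
      rcases hx.1 with rfl | hxB
      · exact Finset.mem_insert_of_mem hzP
      · exact hBP (Finset.mem_sdiff.2 ⟨hxB, hx.2⟩)
    have h1 := rkN_mono (M := M) hsub
    have h2 := rkN_union_le_add_card (M := M) P {u}
    rw [Finset.union_comm, ← Finset.insert_eq, Finset.card_singleton] at h2
    have h3 := rkN_insert_sdiff_coloops_eq_five_of_thin hG hd hk hB hz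
    omega
  have hzu : z ≠ u := fun h => hzB (h ▸ huB)
  -- the thin covering preimages of `Q = B ∪ {z}` are among the faces at `u` and `z`
  set Q := insert z B with hQdef
  have hQG : Q ⊆ G := Finset.insert_subset hzG hBG
  have hL1 : L1 M 5 G Q ≤ 7 / 12 := by
    unfold L1
    set Pre := (coverPreimages M (Uq M (5 + 2) 5) G Q).filter (fun B => B ∉ lay0 M 5 G) with hPre
    have hthin : ∀ F ∈ Pre, F ∈ thinMembers M 5 G := by
      intro F hF
      rw [hPre, Finset.mem_filter, mem_coverPreimages] at hF
      exact mem_thinMembers.2 ⟨hF.1.1, hF.2⟩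
    have hreq : ∀ F ∈ Pre, req M 5 F ≤ 7 / 24 := fun F hF => req_le_of_thin_two_one hG hd (hthin F hF)
    have hPsub : Pre ⊆ ({u, z} : Finset α).image (fun w => Q.erase w) := by
      intro F hF
      have h1 := thin_coverPreimages_subset_image_coloops hG hd' Q hF
      obtain ⟨w, hw, rfl⟩ := Finset.mem_image.1 h1
      have hwQ : w ∈ Q := (Finset.mem_sdiff.1 (mem_coloops.1 hw).1).1
      rw [Finset.mem_image]
      refine ⟨w, ?_, rfl⟩
      rw [Finset.mem_insert, Finset.mem_singleton]
      by_contra hcon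
      push Not at hcon
      -- the face contains both `u` and `z`
      have huF : u ∈ Q.erase w := Finset.mem_erase.2 ⟨fun h => hcon.1 h.symm, Finset.mem_insert_of_mem huB⟩
      have hzF : z ∈ Q.erase w := Finset.mem_erase.2 ⟨fun h => hcon.2 h.symm, Finset.mem_insert_self _ _⟩
      exact hnot (hthin _ hF) hu3 hz3 hzu.symm ⟨huF, hzF⟩
    have hPcard : Pre.card ≤ 2 := by
      refine (Finset.card_le_card hPsub).trans (Finset.card_image_le.trans ?_)
      rw [Finset.card_pair hzu.symm]
    calc ∑ F ∈ Pre, req M 5 F ≤ ∑ _F ∈ Pre, (7 / 24 : ℚ) := Finset.sum_le_sum hreq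
      _ = (Pre.card : ℚ) * (7 / 24) := by rw [Finset.sum_const, nsmul_eq_mul]
      _ ≤ 2 * (7 / 24) := by
          have : (Pre.card : ℚ) ≤ 2 := by exact_mod_cast hPcard
          nlinarith
      _ = 7 / 12 := by norm_num
  have hcap := capS_ge_eleven_eighteenths_two_one hd hk hQG
  have hfS : fS M 5 G Q = 1 := by
    unfold fS
    rw [if_pos (by linarith)]
  unfold loss
  rw [← hQdef, hfS]
  ring

open scoped Classical in
/-- **THE CELL `(2, 1)` WITH TWO FAT CLOSURES WHOSE MISSED PAIRS MEET SATISFIES (LI_G)**: the cell is lossless. -/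
theorem localShadowHall_two_one_five_two_fat_meet (hG : G ∈ flatsQ M (5 + 1)) (hd : (gr M \ G).card = 2)
    (hk : kColoops M G = 1) {B₀ B₁ : Finset α} (hB₀ : B₀ ∈ thinMembers M 5 G) (hB₁ : B₁ ∈ thinMembers M 5 G)
    (hm₀ : (G \ clF M B₀).card ≤ 2) (hm₁ : (G \ clF M B₁).card ≤ 2) (hne : clF M B₀ ≠ clF M B₁)
    (hmeet : ¬ Disjoint (G \ clF M B₀) (G \ clF M B₁)) : LocalShadowHall M 5 G := by
  have hd' : (gr M \ G).card ≤ 5 := by omega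
  -- the common missed point `c` and the other points `a`, `b`
  rw [Finset.not_disjoint_iff] at hmeet
  obtain ⟨c, hc₀, hc₁⟩ := hmeet
  have hm₀' : (G \ clF M B₀).card = 2 := by
    have := two_le_card_sdiff_of_not_lay0 hG hd' (mem_thinMembers.1 hB₀).1 (mem_thinMembers.1 hB₀).2
    omega
  have hm₁' : (G \ clF M B₁).card = 2 := by
    have := two_le_card_sdiff_of_not_lay0 hG hd' (mem_thinMembers.1 hB₁).1 (mem_thinMembers.1 hB₁).2
    omega
  have hother : ∀ {S : Finset α}, S.card = 2 → ∃ a ∈ S, a ≠ c := by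
    intro S hS
    by_contra hcon
    push Not at hcon
    have := Finset.card_le_card (fun x hx => Finset.mem_singleton.2 (hcon x hx) : S ⊆ {c})
    rw [Finset.card_singleton] at this
    omega
  obtain ⟨a, ha₀, hac⟩ := hother hm₀'
  obtain ⟨b, hb₁, hbc⟩ := hother hm₁'
  have hH₀ : G \ clF M B₀ = {a, c} := by
    symm
    apply Finset.eq_of_subset_of_card_le
    · intro x hx
      rw [Finset.mem_insert, Finset.mem_singleton] at hx
      rcases hx with rfl | rfl
      · exact ha₀
      · exact hc₀
    · rw [hm₀', Finset.card_pair hac]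
  have hH₁ : G \ clF M B₁ = {b, c} := by
    symm
    apply Finset.eq_of_subset_of_card_le
    · intro x hx
      rw [Finset.mem_insert, Finset.mem_singleton] at hx
      rcases hx with rfl | rfl
      · exact hb₁
      · exact hc₁
    · rw [hm₁', Finset.card_pair hbc]
  have hab : a ≠ b := by
    intro h
    apply hne
    have hB₀' : B₀ ∈ membersIn M (Uq M (5 + 2) 5) G := (mem_thinMembers.1 hB₀).1
    have hB₁' : B₁ ∈ membersIn M (Uq M (5 + 2) 5) G := (mem_thinMembers.1 hB₁).1
    have hH₀G : clF M B₀ ⊆ G := (mem_membersIn.1 hB₀').2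
    have hH₁G : clF M B₁ ⊆ G := (mem_membersIn.1 hB₁').2
    have h1 : G \ clF M B₀ = G \ clF M B₁ := by rw [hH₀, hH₁, h]
    calc clF M B₀ = G \ (G \ clF M B₀) := (Finset.sdiff_sdiff_eq_self hH₀G).symm
      _ = G \ (G \ clF M B₁) := by rw [h1]
      _ = clF M B₁ := Finset.sdiff_sdiff_eq_self hH₁G
  apply localShadowHall_of_loss_eq_zero hG hd'
  intro B hB z hz
  exact loss_eq_zero_of_two_fat_meet hG hd hk hB₀ hB₁ hH₀ hH₁ hab hac hbc hB hz

end Lossless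

end PercRepro.Shadow
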